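/-
Width seat `ym-line-cbag-p1-w3` (prover-ym-line-cbag-p1-w3-g10-0; own items stmt-QuantumFields-22254 `BoxFloorAllGroups` /
stmt-QuantumFields-22893 `ExpChartPackage2` CLOSED proved).  Glue towards the TWO-SIDED six-plane DLR transfer (node
`Theorems.TreeLevelLimitWitness`): the per-datum UPPER inputs — the 36 pair covariances under a crude-good datum are dominated by the cold-wall ones
up to the datum ceiling, and the kernel-mean excesses are bounded above (interior bound of the harmonic background).
-/
import Summits.QuantumFields.YangMills.Theorems.SixPlaneColdBoxGoodDatumSixPlaneForm

/-!
# LINE 3 `SixPlaneColdBox`, glue: the per-datum UPPER inputs of the two-sided six-plane DLR transfer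

Mirror image of `SixPlaneColdBoxGoodDatumCovLower` / `SixPlaneColdBoxGoodDatumSixPlaneForm`.  Per crude-good datum `ω` (scale `β^{2(θ/5)−1}`,
box `H = ⌈β^θ⌉`, separation `T = ⌈β^A⌉`, `0 < A < θ ≤ 1/200`) the landed datum-minus-flat comparisons `datumMinusFlat_sharp`
(`|β²Cov_ω − β²Cov_1 − 2β·S_{qq'}·C_D| ≤ 2β^{−1/5}`, `|βE_ω − βE_1 − β·S_q| ≤ 2β^{−1/4}`, `S_q = Σ_c F̄_c(q)² ≥ 0`, `2|S_{qq'}| ≤ S_q + S_{q'}`) are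
TWO-sided, so with the kernel-mean excesses `M_q(ω) = β·E_ω c_q − β·E_1 c_q + 2β^{−1/4} ≥ β·S_q` and the kernel bound `|C_D| ≤ Kβ^{−4A}`:

* `pair_cov_upper_of_expansions` — `a ≤ b + K₄(M_x + M_y) + e₅` (the bookkeeping twin of `pair_cov_lower_of_expansions`);
* **`sixPlane_goodDatum_cov_upper`** — for every compact simple `G`, `r`, `0 < A < θ ≤ 1/200`: `∃ K, C_S ≥ 0, β₀`, for `β ≥ β₀` and crude-good
  `ω`, in every plane `q` (at the centre `c_H` and at `c_H + Te₀`): `0 ≤ M_q(ω) ≤ C_S·β^{2θ/5} + 4β^{−1/4}` and `|βE_ω c_q − βE_1 c_q| ≤ M_q(ω) + 2β^{−1/4}`,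
  and `Σ_q Σ_{q'} β²Cov_ω(c_q, c'_{q'}) ≤ Σ_q Σ_{q'} [β²Cov_1(c_q, c'_{q'}) + K·β^{−4A}·(M_q + M'_{q'}) + 2β^{−1/5}]`.
  The SUP bound `β·S_q ≤ C_S β^{2θ/5}` (`C_S = 625·C²·|CE|`) is the interior estimate of the harmonic background
  `|F̄_c(q)| ≤ C√(E_c)/H²` (`dirBackground_interior_bounds`, `sCirc_eq_d₁`) with the total energy `Σ_c E_c ≤ CE(2H+3)⁴β^{2θ/5−1}` of the chart datum;
* **`sixPlane_goodDatum_hup`** — the same with the double sums folded into covariances of the six-plane sums `F = Σ_q c_{(c_H;q)}`,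
  `F' = Σ_q c_{(c_H+Te₀;q)}` (`cov_sum_sum_eq`), i.e. the `hup` input of `total_covariance_upper_bound_dev`.

No sorry; no new definition; standard axioms.  NOT a claim about the Yang–Mills mass gap: glue for the RECORD-type node `TreeLevelLimitWitness`.
-/

set_option autoImplicit false

noncomputable section

open MeasureTheory ProbabilityTheory Finset Real Filter Topology Metric
open scoped ENNReal
open Literature.Probability.LatticeModels (Site glueWith)
open Literature.MathematicalPhysics.QuantumLattice
open Literature.MathematicalPhysics.QuantumFieldTheory
open Literature.MathematicalPhysics.QuantumFieldTheory.LatticeMaxwell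
open Literature.MathematicalPhysics.QuantumFieldTheory.AxialGauge
open Summit.QuantumFields.YangMills.Theorems.WeakCouplingRates
open Summit.QuantumFields.YangMills.Theorems.FreeEnergyLogCoefficient
open Literature.MathematicalPhysics.QuantumFieldTheory.LatticeForm (d₁)

namespace Summit.QuantumFields.YangMills.Theorems.ColdBoxAllGroups

/-! ## Real bookkeeping -/

/-- The UPPER bookkeeping of one plane pair: from `|a − b − 2β·Sxy·C| ≤ e₅`, `2|Sxy| ≤ Sx + Sy`, `|C| ≤ K₄`, `β·Sx ≤ Mx`, `β·Sy ≤ My`: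
`a ≤ b + K₄(Mx + My) + e₅`. -/
theorem pair_cov_upper_of_expansions {a b C Sxy Sx Sy Mx My K₄ e₅ β : ℝ} (hβ : 0 ≤ β)
    (hcov : |a - b - 2 * β * Sxy * C| ≤ e₅) (hxy : 2 * |Sxy| ≤ Sx + Sy) (hC : |C| ≤ K₄)
    (hMx : β * Sx ≤ Mx) (hMy : β * Sy ≤ My) : a ≤ b + K₄ * (Mx + My) + e₅ := by
  have hK₄ : 0 ≤ K₄ := (abs_nonneg C).trans hC
  have hS : 0 ≤ Sx + Sy := le_trans (by positivity) hxy
  have h1 : |2 * β * Sxy * C| ≤ β * ((Sx + Sy) * K₄) := by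
    rw [show 2 * β * Sxy * C = β * ((2 * Sxy) * C) by ring, abs_mul, abs_of_nonneg hβ, abs_mul]
    refine mul_le_mul_of_nonneg_left ?_ hβ
    have h2 : |2 * Sxy| = 2 * |Sxy| := by rw [abs_mul, abs_two]
    rw [h2]
    exact mul_le_mul hxy hC (abs_nonneg _) hS
  have h2 : β * ((Sx + Sy) * K₄) ≤ K₄ * (Mx + My) := by nlinarith
  have h3 := (abs_le.1 (h1.trans h2)).2
  have h4 := (abs_le.1 hcov).2
  linarith

/-- Squares under an absolute-value bound by `C·√E/H²`: `x² ≤ C²·E/H⁴` (`E ≥ 0`). -/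
theorem sq_le_of_abs_le_sqrt_div {x C E H : ℝ} (hE : 0 ≤ E) (h : |x| ≤ C * Real.sqrt E / H ^ 2) :
    x ^ 2 ≤ C ^ 2 * E / H ^ 4 := by
  have h0 : 0 ≤ C * Real.sqrt E / H ^ 2 := (abs_nonneg x).trans h
  have h1 : x ^ 2 ≤ (C * Real.sqrt E / H ^ 2) ^ 2 := by
    rw [← sq_abs]; exact pow_le_pow_left₀ (abs_nonneg x) h 2
  have e : (C * Real.sqrt E / H ^ 2) ^ 2 = C ^ 2 * E / H ^ 4 := by
    rw [div_pow, mul_pow, Real.sq_sqrt hE]; ring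
  rwa [e] at h1

/-! ## The per-datum upper bound -/

/-- **The 36 pair covariances of the six-plane density under a crude-good datum are dominated by the cold-wall ones up to the datum ceiling and
`2β^{−1/5}` per pair; the kernel-mean excesses are nonnegative, bounded by `C_S β^{2θ/5} + 4β^{−1/4}`, and control `|βE_ω c_q − βE_1 c_q|`.**  See the
module docstring (`H = ⌈β^θ⌉`, `T = ⌈β^A⌉`, `0 < A < θ ≤ 1/200`, crude-good scale `β^{2(θ/5)−1}`). -/
theorem sixPlane_goodDatum_cov_upper
    (G : Type) [Group G] [TopologicalSpace G] [IsTopologicalGroup G] [CompactSpace G] [MeasurableSpace G] [BorelSpace G]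
    (hG : IsCompactSimpleLieGroup G) (r : LatticeRep G) {A θ : ℝ} (hA : 0 < A) (hAθ : A < θ) (hθ2 : θ ≤ 1 / 200) :
    ∃ K : ℝ, 0 ≤ K ∧ ∃ CS : ℝ, 0 ≤ CS ∧ ∃ β₀ : ℝ, ∀ β : ℝ, β₀ ≤ β → ∀ ω : LGConfig 4 G, CrudeGoodG r.ρ β (θ / 5) ⌈β ^ θ⌉₊ ω →
      (∀ q : {q : Fin 4 × Fin 4 // q.1 < q.2},
        0 ≤ β * (∫ U, plaqCostAt r.ρ (boxCentre ⌈β ^ θ⌉₊) q.1.1 q.1.2 U ∂(boxKernelG r.ρ β ⌈β ^ θ⌉₊ ω)) -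
            β * (∫ U, plaqCostAt r.ρ (boxCentre ⌈β ^ θ⌉₊) q.1.1 q.1.2 U ∂(boxState r.ρ β ⌈β ^ θ⌉₊)) + 2 * β ^ (-(1 / 4 : ℝ)) ∧
        β * (∫ U, plaqCostAt r.ρ (boxCentre ⌈β ^ θ⌉₊) q.1.1 q.1.2 U ∂(boxKernelG r.ρ β ⌈β ^ θ⌉₊ ω)) -
            β * (∫ U, plaqCostAt r.ρ (boxCentre ⌈β ^ θ⌉₊) q.1.1 q.1.2 U ∂(boxState r.ρ β ⌈β ^ θ⌉₊)) + 2 * β ^ (-(1 / 4 : ℝ)) ≤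
          CS * β ^ (2 * (θ / 5)) + 4 * β ^ (-(1 / 4 : ℝ)) ∧
        |β * (∫ U, plaqCostAt r.ρ (boxCentre ⌈β ^ θ⌉₊) q.1.1 q.1.2 U ∂(boxKernelG r.ρ β ⌈β ^ θ⌉₊ ω)) -
            β * (∫ U, plaqCostAt r.ρ (boxCentre ⌈β ^ θ⌉₊) q.1.1 q.1.2 U ∂(boxState r.ρ β ⌈β ^ θ⌉₊))| ≤
          (β * (∫ U, plaqCostAt r.ρ (boxCentre ⌈β ^ θ⌉₊) q.1.1 q.1.2 U ∂(boxKernelG r.ρ β ⌈β ^ θ⌉₊ ω)) -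
            β * (∫ U, plaqCostAt r.ρ (boxCentre ⌈β ^ θ⌉₊) q.1.1 q.1.2 U ∂(boxState r.ρ β ⌈β ^ θ⌉₊)) + 2 * β ^ (-(1 / 4 : ℝ))) +
            2 * β ^ (-(1 / 4 : ℝ))) ∧
      (∀ q' : {q : Fin 4 × Fin 4 // q.1 < q.2},
        0 ≤ β * (∫ U, plaqCostAt r.ρ (boxCentre ⌈β ^ θ⌉₊ + Pi.single 0 (⌈β ^ A⌉₊ : ℤ)) q'.1.1 q'.1.2 U ∂(boxKernelG r.ρ β ⌈β ^ θ⌉₊ ω)) -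
            β * (∫ U, plaqCostAt r.ρ (boxCentre ⌈β ^ θ⌉₊ + Pi.single 0 (⌈β ^ A⌉₊ : ℤ)) q'.1.1 q'.1.2 U ∂(boxState r.ρ β ⌈β ^ θ⌉₊)) +
            2 * β ^ (-(1 / 4 : ℝ)) ∧
        β * (∫ U, plaqCostAt r.ρ (boxCentre ⌈β ^ θ⌉₊ + Pi.single 0 (⌈β ^ A⌉₊ : ℤ)) q'.1.1 q'.1.2 U ∂(boxKernelG r.ρ β ⌈β ^ θ⌉₊ ω)) -
            β * (∫ U, plaqCostAt r.ρ (boxCentre ⌈β ^ θ⌉₊ + Pi.single 0 (⌈β ^ A⌉₊ : ℤ)) q'.1.1 q'.1.2 U ∂(boxState r.ρ β ⌈β ^ θ⌉₊)) +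
            2 * β ^ (-(1 / 4 : ℝ)) ≤ CS * β ^ (2 * (θ / 5)) + 4 * β ^ (-(1 / 4 : ℝ)) ∧
        |β * (∫ U, plaqCostAt r.ρ (boxCentre ⌈β ^ θ⌉₊ + Pi.single 0 (⌈β ^ A⌉₊ : ℤ)) q'.1.1 q'.1.2 U ∂(boxKernelG r.ρ β ⌈β ^ θ⌉₊ ω)) -
            β * (∫ U, plaqCostAt r.ρ (boxCentre ⌈β ^ θ⌉₊ + Pi.single 0 (⌈β ^ A⌉₊ : ℤ)) q'.1.1 q'.1.2 U ∂(boxState r.ρ β ⌈β ^ θ⌉₊))| ≤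
          (β * (∫ U, plaqCostAt r.ρ (boxCentre ⌈β ^ θ⌉₊ + Pi.single 0 (⌈β ^ A⌉₊ : ℤ)) q'.1.1 q'.1.2 U ∂(boxKernelG r.ρ β ⌈β ^ θ⌉₊ ω)) -
            β * (∫ U, plaqCostAt r.ρ (boxCentre ⌈β ^ θ⌉₊ + Pi.single 0 (⌈β ^ A⌉₊ : ℤ)) q'.1.1 q'.1.2 U ∂(boxState r.ρ β ⌈β ^ θ⌉₊)) +
            2 * β ^ (-(1 / 4 : ℝ))) + 2 * β ^ (-(1 / 4 : ℝ))) ∧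
      ∑ q : {q : Fin 4 × Fin 4 // q.1 < q.2}, ∑ q' : {q : Fin 4 × Fin 4 // q.1 < q.2},
          β ^ 2 * ((∫ U, plaqCostAt r.ρ (boxCentre ⌈β ^ θ⌉₊) q.1.1 q.1.2 U *
                plaqCostAt r.ρ (boxCentre ⌈β ^ θ⌉₊ + Pi.single 0 (⌈β ^ A⌉₊ : ℤ)) q'.1.1 q'.1.2 U ∂(boxKernelG r.ρ β ⌈β ^ θ⌉₊ ω)) -
              (∫ U, plaqCostAt r.ρ (boxCentre ⌈β ^ θ⌉₊) q.1.1 q.1.2 U ∂(boxKernelG r.ρ β ⌈β ^ θ⌉₊ ω)) *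
                (∫ U, plaqCostAt r.ρ (boxCentre ⌈β ^ θ⌉₊ + Pi.single 0 (⌈β ^ A⌉₊ : ℤ)) q'.1.1 q'.1.2 U ∂(boxKernelG r.ρ β ⌈β ^ θ⌉₊ ω))) ≤
        ∑ q : {q : Fin 4 × Fin 4 // q.1 < q.2}, ∑ q' : {q : Fin 4 × Fin 4 // q.1 < q.2},
          (β ^ 2 * ((∫ U, plaqCostAt r.ρ (boxCentre ⌈β ^ θ⌉₊) q.1.1 q.1.2 U *
                plaqCostAt r.ρ (boxCentre ⌈β ^ θ⌉₊ + Pi.single 0 (⌈β ^ A⌉₊ : ℤ)) q'.1.1 q'.1.2 U ∂(boxState r.ρ β ⌈β ^ θ⌉₊)) -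
              (∫ U, plaqCostAt r.ρ (boxCentre ⌈β ^ θ⌉₊) q.1.1 q.1.2 U ∂(boxState r.ρ β ⌈β ^ θ⌉₊)) *
                (∫ U, plaqCostAt r.ρ (boxCentre ⌈β ^ θ⌉₊ + Pi.single 0 (⌈β ^ A⌉₊ : ℤ)) q'.1.1 q'.1.2 U ∂(boxState r.ρ β ⌈β ^ θ⌉₊))) +
            K * β ^ (-(4 * A)) *
              ((β * (∫ U, plaqCostAt r.ρ (boxCentre ⌈β ^ θ⌉₊) q.1.1 q.1.2 U ∂(boxKernelG r.ρ β ⌈β ^ θ⌉₊ ω)) -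
                  β * (∫ U, plaqCostAt r.ρ (boxCentre ⌈β ^ θ⌉₊) q.1.1 q.1.2 U ∂(boxState r.ρ β ⌈β ^ θ⌉₊)) + 2 * β ^ (-(1 / 4 : ℝ))) +
                (β * (∫ U, plaqCostAt r.ρ (boxCentre ⌈β ^ θ⌉₊ + Pi.single 0 (⌈β ^ A⌉₊ : ℤ)) q'.1.1 q'.1.2 U ∂(boxKernelG r.ρ β ⌈β ^ θ⌉₊ ω)) -
                  β * (∫ U, plaqCostAt r.ρ (boxCentre ⌈β ^ θ⌉₊ + Pi.single 0 (⌈β ^ A⌉₊ : ℤ)) q'.1.1 q'.1.2 U ∂(boxState r.ρ β ⌈β ^ θ⌉₊)) +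
                  2 * β ^ (-(1 / 4 : ℝ)))) +
            2 * β ^ (-(1 / 5 : ℝ))) := by
  have hθ : 0 < θ := hA.trans hAθ
  obtain ⟨K, hK0, βK, hK⟩ := abs_boxDirProjKernel_centre_pair_le_rpow hA hAθ
  obtain ⟨CE, β₁, hD⟩ := datumMinusFlat_sharp G hG r hθ hθ2
  obtain ⟨β₂, hβ₂1, h16⟩ := exists_const_mul_rpow_le_rpow 16 hAθ
  obtain ⟨C, hC0, hI⟩ := dirBackground_interior_bounds
  -- `⌈β^θ⌉ ≥ 8` eventually
  obtain ⟨β₃, hβ₃⟩ := Filter.eventually_atTop.1 ((tendsto_rpow_atTop hθ).eventually_ge_atTop (8 : ℝ))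
  refine ⟨K, hK0, 625 * C ^ 2 * |CE|, by positivity, max (max (max βK β₁) β₂) β₃, fun β hβ ω hω => ?_⟩
  have hbK : βK ≤ β := (((le_max_left _ _).trans (le_max_left _ _)).trans (le_max_left _ _)).trans hβ
  have hb₁ : β₁ ≤ β := (((le_max_right _ _).trans (le_max_left _ _)).trans (le_max_left _ _)).trans hβ
  have hb₂ : β₂ ≤ β := ((le_max_right _ _).trans (le_max_left _ _)).trans hβ
  have hb₃ : β₃ ≤ β := (le_max_right _ _).trans hβ
  have hβ1 : 1 ≤ β := hβ₂1.trans hb₂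
  have hβ0 : 0 ≤ β := by linarith
  have hβpos : 0 < β := by linarith
  -- `8T ≤ H`, hence both sites are within `H/8` of the centre
  have h8T : 8 * ⌈β ^ A⌉₊ ≤ ⌈β ^ θ⌉₊ := by
    have h2 := natCeil_rpow_le_two_mul hβ1 hA.le
    have h := h16 β hb₂
    have hH : β ^ θ ≤ (⌈β ^ θ⌉₊ : ℝ) := Nat.le_ceil _
    have hr : (8 * ⌈β ^ A⌉₊ : ℝ) ≤ (⌈β ^ θ⌉₊ : ℝ) := by linarith
    exact_mod_cast hr
  have hH8 : 8 ≤ ⌈β ^ θ⌉₊ := by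
    have : (8 : ℝ) ≤ (⌈β ^ θ⌉₊ : ℝ) := (hβ₃ β hb₃).trans (Nat.le_ceil _)
    exact_mod_cast this
  have hH1r : (1 : ℝ) ≤ (⌈β ^ θ⌉₊ : ℝ) := by exact_mod_cast (show 1 ≤ ⌈β ^ θ⌉₊ by omega)
  have hx : ∀ n : Fin 4, 8 * |(boxCentre ⌈β ^ θ⌉₊ : Site 4) n - (⌈β ^ θ⌉₊ : ℤ)| ≤ (⌈β ^ θ⌉₊ : ℤ) := (centre_pair_near_centre h8T).1
  have hy : ∀ n : Fin 4, 8 * |(boxCentre ⌈β ^ θ⌉₊ + Pi.single 0 (⌈β ^ A⌉₊ : ℤ) : Site 4) n - (⌈β ^ θ⌉₊ : ℤ)| ≤ (⌈β ^ θ⌉₊ : ℤ) :=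
    (centre_pair_near_centre h8T).2
  -- the expansion data of this datum
  obtain ⟨ϑ, s, henergy, hcov, hmean⟩ := hD β hb₁ ω hω
  have hEc0 : ∀ c, 0 ≤ formM (fun e => e ∉ dirFreeEdges ⌈β ^ θ⌉₊) dirCorner (2 * ⌈β ^ θ⌉₊ + 3) (ϑ c) (s c) := fun c => by
    simp only [formM]; exact Finset.sum_nonneg fun p _ => sq_nonneg _
  -- the SUP bound on the background energy at a near-centre plaquette
  have hsupS : ∀ (x : Site 4), (∀ n : Fin 4, 8 * |x n - (⌈β ^ θ⌉₊ : ℤ)| ≤ (⌈β ^ θ⌉₊ : ℤ)) → ∀ (i j : Fin 4),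
      β * ∑ c, sCirc (glue (pin := fun e => e ∉ dirFreeEdges ⌈β ^ θ⌉₊) dirCorner (2 * ⌈β ^ θ⌉₊ + 3) (ϑ c) (mean (fun e => e ∉ dirFreeEdges ⌈β ^ θ⌉₊) dirCorner (2 * ⌈β ^ θ⌉₊ + 3) (ϑ c))) (x, i, j) ^ 2 ≤ 625 * C ^ 2 * |CE| * β ^ (2 * (θ / 5)) := by
    intro x hxn i j
    have hsq : ∀ c, sCirc (glue (pin := fun e => e ∉ dirFreeEdges ⌈β ^ θ⌉₊) dirCorner (2 * ⌈β ^ θ⌉₊ + 3) (ϑ c) (mean (fun e => e ∉ dirFreeEdges ⌈β ^ θ⌉₊) dirCorner (2 * ⌈β ^ θ⌉₊ + 3) (ϑ c))) (x, i, j) ^ 2 ≤ C ^ 2 * formM (fun e => e ∉ dirFreeEdges ⌈β ^ θ⌉₊) dirCorner (2 * ⌈β ^ θ⌉₊ + 3) (ϑ c) (s c) / (⌈β ^ θ⌉₊ : ℝ) ^ 4 := by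
      intro c
      have hb : |sCirc (glue (pin := fun e => e ∉ dirFreeEdges ⌈β ^ θ⌉₊) dirCorner (2 * ⌈β ^ θ⌉₊ + 3) (ϑ c) (mean (fun e => e ∉ dirFreeEdges ⌈β ^ θ⌉₊) dirCorner (2 * ⌈β ^ θ⌉₊ + 3) (ϑ c))) (x, i, j)| ≤ C * Real.sqrt (formM (fun e => e ∉ dirFreeEdges ⌈β ^ θ⌉₊) dirCorner (2 * ⌈β ^ θ⌉₊ + 3) (ϑ c) (s c)) / (⌈β ^ θ⌉₊ : ℝ) ^ 2 := by
        rw [sCirc_eq_d₁]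
        exact (hI ⌈β ^ θ⌉₊ hH8 (ϑ c) (s c) x hxn i j).1
      exact sq_le_of_abs_le_sqrt_div (hEc0 c) hb
    have h1 : ∑ c, sCirc (glue (pin := fun e => e ∉ dirFreeEdges ⌈β ^ θ⌉₊) dirCorner (2 * ⌈β ^ θ⌉₊ + 3) (ϑ c) (mean (fun e => e ∉ dirFreeEdges ⌈β ^ θ⌉₊) dirCorner (2 * ⌈β ^ θ⌉₊ + 3) (ϑ c))) (x, i, j) ^ 2 ≤ C ^ 2 * (∑ c, formM (fun e => e ∉ dirFreeEdges ⌈β ^ θ⌉₊) dirCorner (2 * ⌈β ^ θ⌉₊ + 3) (ϑ c) (s c)) / (⌈β ^ θ⌉₊ : ℝ) ^ 4 := by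
      calc ∑ c, sCirc (glue (pin := fun e => e ∉ dirFreeEdges ⌈β ^ θ⌉₊) dirCorner (2 * ⌈β ^ θ⌉₊ + 3) (ϑ c) (mean (fun e => e ∉ dirFreeEdges ⌈β ^ θ⌉₊) dirCorner (2 * ⌈β ^ θ⌉₊ + 3) (ϑ c))) (x, i, j) ^ 2 ≤ ∑ c, C ^ 2 * formM (fun e => e ∉ dirFreeEdges ⌈β ^ θ⌉₊) dirCorner (2 * ⌈β ^ θ⌉₊ + 3) (ϑ c) (s c) / (⌈β ^ θ⌉₊ : ℝ) ^ 4 := Finset.sum_le_sum fun c _ => hsq c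
        _ = C ^ 2 * (∑ c, formM (fun e => e ∉ dirFreeEdges ⌈β ^ θ⌉₊) dirCorner (2 * ⌈β ^ θ⌉₊ + 3) (ϑ c) (s c)) / (⌈β ^ θ⌉₊ : ℝ) ^ 4 := by rw [Finset.mul_sum, Finset.sum_div]
    have h2 : C ^ 2 * (∑ c, formM (fun e => e ∉ dirFreeEdges ⌈β ^ θ⌉₊) dirCorner (2 * ⌈β ^ θ⌉₊ + 3) (ϑ c) (s c)) / (⌈β ^ θ⌉₊ : ℝ) ^ 4 ≤ C ^ 2 * (|CE| * (2 * (⌈β ^ θ⌉₊ : ℝ) + 3) ^ 4 * β ^ (2 * (θ / 5) - 1)) / (⌈β ^ θ⌉₊ : ℝ) ^ 4 := by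
      have hle : ∑ c, formM (fun e => e ∉ dirFreeEdges ⌈β ^ θ⌉₊) dirCorner (2 * ⌈β ^ θ⌉₊ + 3) (ϑ c) (s c) ≤ |CE| * (2 * (⌈β ^ θ⌉₊ : ℝ) + 3) ^ 4 * β ^ (2 * (θ / 5) - 1) :=
        henergy.trans (by gcongr; exact le_abs_self CE)
      gcongr
    have h3 : (2 * (⌈β ^ θ⌉₊ : ℝ) + 3) ^ 4 / (⌈β ^ θ⌉₊ : ℝ) ^ 4 ≤ 625 := by
      rw [div_le_iff₀ (by positivity)]; exact WeakCouplingRates.two_mul_add_three_pow_four_le hH1r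
    have h4 : β * (C ^ 2 * (|CE| * (2 * (⌈β ^ θ⌉₊ : ℝ) + 3) ^ 4 * β ^ (2 * (θ / 5) - 1)) / (⌈β ^ θ⌉₊ : ℝ) ^ 4) ≤
        625 * C ^ 2 * |CE| * β ^ (2 * (θ / 5)) := by
      have epow : β * β ^ (2 * (θ / 5) - 1) = β ^ (2 * (θ / 5)) := by
        rw [← Real.rpow_one_add' hβ0 (by linarith : (1 : ℝ) + (2 * (θ / 5) - 1) ≠ 0)]; ring_nf
      have hHne : (⌈β ^ θ⌉₊ : ℝ) ^ 4 ≠ 0 := by positivity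
      have e : β * (C ^ 2 * (|CE| * (2 * (⌈β ^ θ⌉₊ : ℝ) + 3) ^ 4 * β ^ (2 * (θ / 5) - 1)) / (⌈β ^ θ⌉₊ : ℝ) ^ 4) =
          (C ^ 2 * |CE| * (β * β ^ (2 * (θ / 5) - 1))) * ((2 * (⌈β ^ θ⌉₊ : ℝ) + 3) ^ 4 / (⌈β ^ θ⌉₊ : ℝ) ^ 4) := by
        field_simp
      rw [e, epow]
      have hnn : 0 ≤ C ^ 2 * |CE| * β ^ (2 * (θ / 5)) := by positivity
      calc C ^ 2 * |CE| * β ^ (2 * (θ / 5)) * ((2 * (⌈β ^ θ⌉₊ : ℝ) + 3) ^ 4 / (⌈β ^ θ⌉₊ : ℝ) ^ 4)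
          ≤ C ^ 2 * |CE| * β ^ (2 * (θ / 5)) * 625 := mul_le_mul_of_nonneg_left h3 hnn
        _ = 625 * C ^ 2 * |CE| * β ^ (2 * (θ / 5)) := by ring
    calc β * ∑ c, sCirc (glue (pin := fun e => e ∉ dirFreeEdges ⌈β ^ θ⌉₊) dirCorner (2 * ⌈β ^ θ⌉₊ + 3) (ϑ c) (mean (fun e => e ∉ dirFreeEdges ⌈β ^ θ⌉₊) dirCorner (2 * ⌈β ^ θ⌉₊ + 3) (ϑ c))) (x, i, j) ^ 2 ≤ β * (C ^ 2 * (|CE| * (2 * (⌈β ^ θ⌉₊ : ℝ) + 3) ^ 4 * β ^ (2 * (θ / 5) - 1)) / (⌈β ^ θ⌉₊ : ℝ) ^ 4) :=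
          mul_le_mul_of_nonneg_left (h1.trans h2) hβ0
      _ ≤ 625 * C ^ 2 * |CE| * β ^ (2 * (θ / 5)) := h4
  -- per-plane facts from the mean comparison
  have hplane : ∀ (x : Site 4), (∀ n : Fin 4, 8 * |x n - (⌈β ^ θ⌉₊ : ℤ)| ≤ (⌈β ^ θ⌉₊ : ℤ)) → ∀ (q : {q : Fin 4 × Fin 4 // q.1 < q.2}),
      0 ≤ β * (∫ U, plaqCostAt r.ρ x q.1.1 q.1.2 U ∂(boxKernelG r.ρ β ⌈β ^ θ⌉₊ ω)) -
            β * (∫ U, plaqCostAt r.ρ x q.1.1 q.1.2 U ∂(boxState r.ρ β ⌈β ^ θ⌉₊)) + 2 * β ^ (-(1 / 4 : ℝ)) ∧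
        β * (∫ U, plaqCostAt r.ρ x q.1.1 q.1.2 U ∂(boxKernelG r.ρ β ⌈β ^ θ⌉₊ ω)) -
            β * (∫ U, plaqCostAt r.ρ x q.1.1 q.1.2 U ∂(boxState r.ρ β ⌈β ^ θ⌉₊)) + 2 * β ^ (-(1 / 4 : ℝ)) ≤
          625 * C ^ 2 * |CE| * β ^ (2 * (θ / 5)) + 4 * β ^ (-(1 / 4 : ℝ)) ∧
        |β * (∫ U, plaqCostAt r.ρ x q.1.1 q.1.2 U ∂(boxKernelG r.ρ β ⌈β ^ θ⌉₊ ω)) -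
            β * (∫ U, plaqCostAt r.ρ x q.1.1 q.1.2 U ∂(boxState r.ρ β ⌈β ^ θ⌉₊))| ≤
          (β * (∫ U, plaqCostAt r.ρ x q.1.1 q.1.2 U ∂(boxKernelG r.ρ β ⌈β ^ θ⌉₊ ω)) -
            β * (∫ U, plaqCostAt r.ρ x q.1.1 q.1.2 U ∂(boxState r.ρ β ⌈β ^ θ⌉₊)) + 2 * β ^ (-(1 / 4 : ℝ))) + 2 * β ^ (-(1 / 4 : ℝ)) := by
    intro x hxn q
    have hm := abs_le.1 (hmean x hxn q.1.1 q.1.2 q.2)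
    have hS0 : 0 ≤ β * ∑ c, sCirc (glue (pin := fun e => e ∉ dirFreeEdges ⌈β ^ θ⌉₊) dirCorner (2 * ⌈β ^ θ⌉₊ + 3) (ϑ c) (mean (fun e => e ∉ dirFreeEdges ⌈β ^ θ⌉₊) dirCorner (2 * ⌈β ^ θ⌉₊ + 3) (ϑ c))) (x, q.1.1, q.1.2) ^ 2 :=
      mul_nonneg hβ0 (Finset.sum_nonneg fun c _ => sq_nonneg _)
    have hSup := hsupS x hxn q.1.1 q.1.2
    have hb14 : 0 ≤ β ^ (-(1 / 4 : ℝ)) := by positivity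
    refine ⟨by linarith [hm.1], by linarith [hm.2], abs_le.2 ⟨by linarith [hm.1], by linarith [hm.2]⟩⟩
  refine ⟨fun q => hplane _ hx q, fun q' => hplane _ hy q', ?_⟩
  -- the double sum, pair by pair
  refine Finset.sum_le_sum fun q _ => Finset.sum_le_sum fun q' _ => ?_
  have hc := hcov _ _ hx hy q.1.1 q.1.2 q'.1.1 q'.1.2 q.2 q'.2
  have hCK := (hK β hbK q.1.1 q.1.2 q'.1.1 q'.1.2 q.2 q'.2).1
  have hMx := (abs_le.1 (hmean _ hx q.1.1 q.1.2 q.2)).1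
  have hMy := (abs_le.1 (hmean _ hy q'.1.1 q'.1.2 q'.2)).1
  have hxy := two_mul_abs_sum_mul_le Finset.univ
    (fun c => sCirc (glue (pin := fun e => e ∉ dirFreeEdges ⌈β ^ θ⌉₊) dirCorner (2 * ⌈β ^ θ⌉₊ + 3) (ϑ c) (mean (fun e => e ∉ dirFreeEdges ⌈β ^ θ⌉₊) dirCorner (2 * ⌈β ^ θ⌉₊ + 3) (ϑ c))) (boxCentre ⌈β ^ θ⌉₊, q.1.1, q.1.2))
    (fun c => sCirc (glue (pin := fun e => e ∉ dirFreeEdges ⌈β ^ θ⌉₊) dirCorner (2 * ⌈β ^ θ⌉₊ + 3) (ϑ c) (mean (fun e => e ∉ dirFreeEdges ⌈β ^ θ⌉₊) dirCorner (2 * ⌈β ^ θ⌉₊ + 3) (ϑ c))) (boxCentre ⌈β ^ θ⌉₊ + Pi.single 0 (⌈β ^ A⌉₊ : ℤ), q'.1.1, q'.1.2))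
  beta_reduce at hxy
  exact pair_cov_upper_of_expansions hβ0 hc hxy hCK (by linarith) (by linarith)


/-! ## The `(h, k, q)`-form -/

/-- **`hup` of the two-sided six-plane transfer, per crude-good datum, in `β²`-units**: the per-plane excess facts of
`sixPlane_goodDatum_cov_upper` and `β²·Cov_ω(F, F') ≤ β²·Cov_1(F, F') + Σ_q Σ_{q'} [K·β^{−4A}·(M_q(ω) + M'_{q'}(ω)) + 2β^{−1/5}]` with the
covariances of the six-plane sums spelled `∫FF' − ∫F∫F'` (bilinearity `cov_sum_sum_eq`). -/
theorem sixPlane_goodDatum_hup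
    (G : Type) [Group G] [TopologicalSpace G] [IsTopologicalGroup G] [CompactSpace G] [MeasurableSpace G] [BorelSpace G]
    (hG : IsCompactSimpleLieGroup G) (r : LatticeRep G) {A θ : ℝ} (hA : 0 < A) (hAθ : A < θ) (hθ2 : θ ≤ 1 / 200) :
    ∃ K : ℝ, 0 ≤ K ∧ ∃ CS : ℝ, 0 ≤ CS ∧ ∃ β₀ : ℝ, ∀ β : ℝ, β₀ ≤ β → ∀ ω : LGConfig 4 G, CrudeGoodG r.ρ β (θ / 5) ⌈β ^ θ⌉₊ ω →
      (∀ q : {q : Fin 4 × Fin 4 // q.1 < q.2},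
        0 ≤ (β * (∫ U, plaqCostAt r.ρ (boxCentre ⌈β ^ θ⌉₊) q.1.1 q.1.2 U ∂(boxKernelG r.ρ β ⌈β ^ θ⌉₊ ω)) -
            β * (∫ U, plaqCostAt r.ρ (boxCentre ⌈β ^ θ⌉₊) q.1.1 q.1.2 U ∂(boxState r.ρ β ⌈β ^ θ⌉₊)) + 2 * β ^ (-(1 / 4 : ℝ))) ∧
        (β * (∫ U, plaqCostAt r.ρ (boxCentre ⌈β ^ θ⌉₊) q.1.1 q.1.2 U ∂(boxKernelG r.ρ β ⌈β ^ θ⌉₊ ω)) -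
            β * (∫ U, plaqCostAt r.ρ (boxCentre ⌈β ^ θ⌉₊) q.1.1 q.1.2 U ∂(boxState r.ρ β ⌈β ^ θ⌉₊)) + 2 * β ^ (-(1 / 4 : ℝ))) ≤
          CS * β ^ (2 * (θ / 5)) + 4 * β ^ (-(1 / 4 : ℝ)) ∧
        |β * (∫ U, plaqCostAt r.ρ (boxCentre ⌈β ^ θ⌉₊) q.1.1 q.1.2 U ∂(boxKernelG r.ρ β ⌈β ^ θ⌉₊ ω)) -
            β * (∫ U, plaqCostAt r.ρ (boxCentre ⌈β ^ θ⌉₊) q.1.1 q.1.2 U ∂(boxState r.ρ β ⌈β ^ θ⌉₊))| ≤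
          (β * (∫ U, plaqCostAt r.ρ (boxCentre ⌈β ^ θ⌉₊) q.1.1 q.1.2 U ∂(boxKernelG r.ρ β ⌈β ^ θ⌉₊ ω)) -
            β * (∫ U, plaqCostAt r.ρ (boxCentre ⌈β ^ θ⌉₊) q.1.1 q.1.2 U ∂(boxState r.ρ β ⌈β ^ θ⌉₊)) + 2 * β ^ (-(1 / 4 : ℝ))) + 2 * β ^ (-(1 / 4 : ℝ))) ∧
      (∀ q' : {q : Fin 4 × Fin 4 // q.1 < q.2},
        0 ≤ (β * (∫ U, plaqCostAt r.ρ (boxCentre ⌈β ^ θ⌉₊ + Pi.single 0 (⌈β ^ A⌉₊ : ℤ)) q'.1.1 q'.1.2 U ∂(boxKernelG r.ρ β ⌈β ^ θ⌉₊ ω)) -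
            β * (∫ U, plaqCostAt r.ρ (boxCentre ⌈β ^ θ⌉₊ + Pi.single 0 (⌈β ^ A⌉₊ : ℤ)) q'.1.1 q'.1.2 U ∂(boxState r.ρ β ⌈β ^ θ⌉₊)) + 2 * β ^ (-(1 / 4 : ℝ))) ∧
        (β * (∫ U, plaqCostAt r.ρ (boxCentre ⌈β ^ θ⌉₊ + Pi.single 0 (⌈β ^ A⌉₊ : ℤ)) q'.1.1 q'.1.2 U ∂(boxKernelG r.ρ β ⌈β ^ θ⌉₊ ω)) -
            β * (∫ U, plaqCostAt r.ρ (boxCentre ⌈β ^ θ⌉₊ + Pi.single 0 (⌈β ^ A⌉₊ : ℤ)) q'.1.1 q'.1.2 U ∂(boxState r.ρ β ⌈β ^ θ⌉₊)) + 2 * β ^ (-(1 / 4 : ℝ))) ≤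
          CS * β ^ (2 * (θ / 5)) + 4 * β ^ (-(1 / 4 : ℝ)) ∧
        |β * (∫ U, plaqCostAt r.ρ (boxCentre ⌈β ^ θ⌉₊ + Pi.single 0 (⌈β ^ A⌉₊ : ℤ)) q'.1.1 q'.1.2 U ∂(boxKernelG r.ρ β ⌈β ^ θ⌉₊ ω)) -
            β * (∫ U, plaqCostAt r.ρ (boxCentre ⌈β ^ θ⌉₊ + Pi.single 0 (⌈β ^ A⌉₊ : ℤ)) q'.1.1 q'.1.2 U ∂(boxState r.ρ β ⌈β ^ θ⌉₊))| ≤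
          (β * (∫ U, plaqCostAt r.ρ (boxCentre ⌈β ^ θ⌉₊ + Pi.single 0 (⌈β ^ A⌉₊ : ℤ)) q'.1.1 q'.1.2 U ∂(boxKernelG r.ρ β ⌈β ^ θ⌉₊ ω)) -
            β * (∫ U, plaqCostAt r.ρ (boxCentre ⌈β ^ θ⌉₊ + Pi.single 0 (⌈β ^ A⌉₊ : ℤ)) q'.1.1 q'.1.2 U ∂(boxState r.ρ β ⌈β ^ θ⌉₊)) + 2 * β ^ (-(1 / 4 : ℝ))) + 2 * β ^ (-(1 / 4 : ℝ))) ∧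
      β ^ 2 * ((∫ U, (∑ q : {q : Fin 4 × Fin 4 // q.1 < q.2}, plaqCostAt r.ρ (boxCentre ⌈β ^ θ⌉₊) q.1.1 q.1.2 U) *
              (∑ q : {q : Fin 4 × Fin 4 // q.1 < q.2}, plaqCostAt r.ρ (boxCentre ⌈β ^ θ⌉₊ + Pi.single 0 (⌈β ^ A⌉₊ : ℤ)) q.1.1 q.1.2 U) ∂(boxKernelG r.ρ β ⌈β ^ θ⌉₊ ω)) -
            (∫ U, ∑ q : {q : Fin 4 × Fin 4 // q.1 < q.2}, plaqCostAt r.ρ (boxCentre ⌈β ^ θ⌉₊) q.1.1 q.1.2 U ∂(boxKernelG r.ρ β ⌈β ^ θ⌉₊ ω)) *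
              (∫ U, ∑ q : {q : Fin 4 × Fin 4 // q.1 < q.2}, plaqCostAt r.ρ (boxCentre ⌈β ^ θ⌉₊ + Pi.single 0 (⌈β ^ A⌉₊ : ℤ)) q.1.1 q.1.2 U ∂(boxKernelG r.ρ β ⌈β ^ θ⌉₊ ω))) ≤
        β ^ 2 * ((∫ U, (∑ q : {q : Fin 4 × Fin 4 // q.1 < q.2}, plaqCostAt r.ρ (boxCentre ⌈β ^ θ⌉₊) q.1.1 q.1.2 U) *
              (∑ q : {q : Fin 4 × Fin 4 // q.1 < q.2}, plaqCostAt r.ρ (boxCentre ⌈β ^ θ⌉₊ + Pi.single 0 (⌈β ^ A⌉₊ : ℤ)) q.1.1 q.1.2 U) ∂(boxState r.ρ β ⌈β ^ θ⌉₊)) -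
            (∫ U, ∑ q : {q : Fin 4 × Fin 4 // q.1 < q.2}, plaqCostAt r.ρ (boxCentre ⌈β ^ θ⌉₊) q.1.1 q.1.2 U ∂(boxState r.ρ β ⌈β ^ θ⌉₊)) *
              (∫ U, ∑ q : {q : Fin 4 × Fin 4 // q.1 < q.2}, plaqCostAt r.ρ (boxCentre ⌈β ^ θ⌉₊ + Pi.single 0 (⌈β ^ A⌉₊ : ℤ)) q.1.1 q.1.2 U ∂(boxState r.ρ β ⌈β ^ θ⌉₊))) +
          ∑ q : {q : Fin 4 × Fin 4 // q.1 < q.2}, ∑ q' : {q : Fin 4 × Fin 4 // q.1 < q.2},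
            (K * β ^ (-(4 * A)) *
              ((β * (∫ U, plaqCostAt r.ρ (boxCentre ⌈β ^ θ⌉₊) q.1.1 q.1.2 U ∂(boxKernelG r.ρ β ⌈β ^ θ⌉₊ ω)) -
            β * (∫ U, plaqCostAt r.ρ (boxCentre ⌈β ^ θ⌉₊) q.1.1 q.1.2 U ∂(boxState r.ρ β ⌈β ^ θ⌉₊)) + 2 * β ^ (-(1 / 4 : ℝ))) +
                (β * (∫ U, plaqCostAt r.ρ (boxCentre ⌈β ^ θ⌉₊ + Pi.single 0 (⌈β ^ A⌉₊ : ℤ)) q'.1.1 q'.1.2 U ∂(boxKernelG r.ρ β ⌈β ^ θ⌉₊ ω)) -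
            β * (∫ U, plaqCostAt r.ρ (boxCentre ⌈β ^ θ⌉₊ + Pi.single 0 (⌈β ^ A⌉₊ : ℤ)) q'.1.1 q'.1.2 U ∂(boxState r.ρ β ⌈β ^ θ⌉₊)) + 2 * β ^ (-(1 / 4 : ℝ)))) +
              2 * β ^ (-(1 / 5 : ℝ))) := by
  haveI := r.secondCountableTopology
  obtain ⟨K, hK0, CS, hCS0, β₀, h⟩ := sixPlane_goodDatum_cov_upper G hG r hA hAθ hθ2
  refine ⟨K, hK0, CS, hCS0, β₀, fun β hβ ω hω => ?_⟩
  obtain ⟨h1, h2, h3⟩ := h β hβ ω hω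
  refine ⟨h1, h2, ?_⟩
  haveI : IsProbabilityMeasure (boxKernelG r.ρ β ⌈β ^ θ⌉₊ ω) := isProbabilityMeasure_boxKernelG r.ρ r.continuous β _ ω
  haveI : IsProbabilityMeasure (boxState r.ρ β ⌈β ^ θ⌉₊) := isProbabilityMeasure_boxKernelG r.ρ r.continuous β _ (fun _ => 1)
  -- bilinearity under both measures
  have hbil : ∀ (μ : Measure (LGConfig 4 G)) [IsProbabilityMeasure μ],
      (∫ U, (∑ q : {q : Fin 4 × Fin 4 // q.1 < q.2}, plaqCostAt r.ρ (boxCentre ⌈β ^ θ⌉₊) q.1.1 q.1.2 U) *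
          (∑ q : {q : Fin 4 × Fin 4 // q.1 < q.2}, plaqCostAt r.ρ (boxCentre ⌈β ^ θ⌉₊ + Pi.single 0 (⌈β ^ A⌉₊ : ℤ)) q.1.1 q.1.2 U) ∂μ) -
        (∫ U, ∑ q : {q : Fin 4 × Fin 4 // q.1 < q.2}, plaqCostAt r.ρ (boxCentre ⌈β ^ θ⌉₊) q.1.1 q.1.2 U ∂μ) *
          (∫ U, ∑ q : {q : Fin 4 × Fin 4 // q.1 < q.2}, plaqCostAt r.ρ (boxCentre ⌈β ^ θ⌉₊ + Pi.single 0 (⌈β ^ A⌉₊ : ℤ)) q.1.1 q.1.2 U ∂μ) =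
      ∑ q : {q : Fin 4 × Fin 4 // q.1 < q.2}, ∑ q' : {q : Fin 4 × Fin 4 // q.1 < q.2},
        ((∫ U, plaqCostAt r.ρ (boxCentre ⌈β ^ θ⌉₊) q.1.1 q.1.2 U *
            plaqCostAt r.ρ (boxCentre ⌈β ^ θ⌉₊ + Pi.single 0 (⌈β ^ A⌉₊ : ℤ)) q'.1.1 q'.1.2 U ∂μ) -
          (∫ U, plaqCostAt r.ρ (boxCentre ⌈β ^ θ⌉₊) q.1.1 q.1.2 U ∂μ) *
            (∫ U, plaqCostAt r.ρ (boxCentre ⌈β ^ θ⌉₊ + Pi.single 0 (⌈β ^ A⌉₊ : ℤ)) q'.1.1 q'.1.2 U ∂μ)) := by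
    intro μ _
    exact cov_sum_sum_eq μ _ _
      (fun q => integrable_plaqCostAt_of_rep r.ρ r.continuous r.mem_unitary _ _ _ μ)
      (fun q => integrable_plaqCostAt_of_rep r.ρ r.continuous r.mem_unitary _ _ _ μ)
      (fun q q' => integrable_plaqCostAt_mul_of_rep' r.ρ r.continuous r.mem_unitary _ _ _ _ _ _ μ)
  rw [hbil (boxState r.ρ β ⌈β ^ θ⌉₊), hbil (boxKernelG r.ρ β ⌈β ^ θ⌉₊ ω), Finset.mul_sum, Finset.mul_sum, ← Finset.sum_add_distrib]
  refine le_of_eq_of_le ?_ (h3.trans_eq ?_)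
  · refine Finset.sum_congr rfl fun q _ => ?_
    rw [Finset.mul_sum]
  · refine Finset.sum_congr rfl fun q _ => ?_
    rw [Finset.mul_sum, ← Finset.sum_add_distrib]
    refine Finset.sum_congr rfl fun q' _ => ?_
    ring

end Summit.QuantumFields.YangMills.Theorems.ColdBoxAllGroups

end
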